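import Literature.MathematicalPhysics.QuantumFieldTheory.Balaban1983to89.B6HolderNormV1
import Literature.MathematicalPhysics.QuantumFieldTheory.Balaban1983to89.B6InDecayWindowV1
import Literature.MathematicalPhysics.QuantumFieldTheory.Balaban1983to89.B6HolderPairWindowV1

/-!
# `Balaban1983to89.B6NormSuppDecayWindowV1` — T. Bałaban, *Propagators and renormalization transformations for lattice gauge theories. II*,
# Commun. Math. Phys. **96** (1984) 223–250 [Balaban1984PropagatorsII], (2.138) p. 247 with (2.133) p. 247 and p. 238 (*"we take the cube □̃³ and
# identify it with a torus T_□"*): THE BAND BRIDGE FOR HÖLDER-CLASS INPUTS — a member operator of `T_□` with an admissible-input (`NormSupp`)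
# majorant transplanted through a FULL window has a `HasMajorantA` with GLOBAL decay for the census Hölder class at inputs in the middle band
# (the `…B6RandomWalkInputNorm` twin of r03's `…B6InDecayWindowV1.inDecay_window_V1`)

statement-level skeleton of published theorems with citation tags; proofs where landed; nothing here is a claim about the Yang–Mills mass gap

PDF held: `paper:balaban1984-cmp96-propagators-rt-ii` (journal page = PDF page + 222): p. 238 [PDF 16] (□ ⊂ □̃ ⊂ □̃² ⊂ □̃³ = T_□), p. 247 [PDF 25]
((2.133), (2.138): *"|(∇G∇*J)(x)| ≤ O(1)e^{−δ₃d(y,y′)}(‖J‖^{ξ′}_ε + |J|) for 0 < ε < 1, x ∈ Δ(y), supp J ⊂ Δ̃(y′), y′ ∈ Λ_{j′}, ξ′ = L^{−j′}"*, obtained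
*"reasoning in the same way as in the proof of Proposition 2.2"*, i.e. from the walk (2.141) whose letters are the members `G_□` of Prop. 2.5 on `T_□`).

CITATION HEADER (lean-in-tree rule) — WHAT IS REPRODUCED.  Phase-2 file of the `lit-balaban` typed skeleton (HOME `run/shared/lean/pub/lit-balaban/`), seat
**p27 gen 90** (TAKING HOME/STATUS 2026-08-24T22:31Z on p38 g34's named offer = `HOME/lit-balaban-p27/WAKE-2138-legs.md`; stem TAKING 2026-08-25; B6 fold
owner r03); SKELETON rows B6.Eq2.138 × B6.Eq2.133 × B6.Prop2.6 (cells only; decls of record untouched).  r03's `inDecay_window_V1` transports a SUP-class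
majorant `A·e^{−δ|·|_{T_□}}` of a member operator through the full window by cutting the pulled-back input into local block pieces; a HÖLDER-class input
(the data `‖J‖_ε + |J|` of (2.138)) cannot be cut (the cuts create jumps), so the class itself must be transported: THIS FILE proves that the pull-back
`ρJ` of a census input `J` (supported in ONE block `y′` of the band, size `‖J‖_ε + |J| ≤ B` in `…B6HolderNormV1.holderV1/supNormV1`) is an admissible
member input at the member block of any of its active bonds, with radius `L − 1` and size `3B` in the member's `hqB ε + supNormTS`:
* §1 generic class algebra for the IN-REACH class `y′ ∈ S ∧ adm` (`hasMajorantA_inCl_of_hasMajorantA`, `hasMajorantA_inCl_congr_set`,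
  **`hasMajorantA_mul_right_ind`**: a right factor carrying the class into the in-reach class and killing the other inputs gives an indicator kernel);
* §2 WINDOW FACTS: **`supDist_le_supDist_eS`** (member-close to a DEEP point ⟹ globally close — the converse of p22's
  `…B6HolderPairWindowV1.supDist_eS_le`), **`tdist_fibre_le`** (two window bonds in the SAME global block chart to member blocks within `|·|_T ≤ L − 1`:
  the metric form of r03's fibre count `hfib_sites_full`);
* §3 **`normSuppDecay_window_V1`** — hypotheses of `inDecay_window_V1` (corner `x₀ ≥ 0`, full member period inside the box, `L^j ∣ x₀`, the window
  two-level, the reach `S` in the middle band with constant `C`) PLUS `hdeep` (window bonds with block in `S` are `L^j`-deep) and a member majorant on the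
  Hölder class of radius `L − 1`; conclusion `HasMajorantA (geomT D) (blkV1 hN D) (y′ ∈ S ∧ NormSupp (blkV1) {y′} (holderV1 ε + supNormV1)) (ε T′ ρ)
  (3A·e^{2δ/C}·e^{−(δ/((d+1)C))·d_T})`.  The heart (§3, `hqB` step): for a member pair at member distance `< L^j` with an active end, the active end is
  deep, so the pair does not wrap and is a census-admissible pair of the same direction at global distance `≤` the member distance, and since the window
  blocks have level `≥ j` the census quotient `t^{−ε}|J(x) − J(x′)|` dominates the member's; pairs at member distance `≥ L^j` cost `2|J|`.
THEOREMS ONLY (no `def`, no `def … : Prop`); standard axioms.  Imports `…B6HolderNormV1` (p27), `…B6InDecayWindowV1` (r03), `…B6HolderPairWindowV1` (p22).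

HONEST SCOPE / DIVERGENCES.  (1) As in r03's bridge the inputs are restricted to the band (`y′ ∈ S`), outputs anywhere; the rate `δ/((d+1)C)` and the
factor `3` are ours.  (2) The member radius `L − 1` reflects that a census block of level `j + 1` is `L^{d+1}` member blocks.  (3) Bookkeeping over
landed estimates; the cube instance and the member (1.112) are in `…B6CubeNormSuppInDecayV1`; NOT summit progress.  Unit `lit-balaban-p27` (gen 90),
2026-08-25.
-/

noncomputable section

open scoped BigOperators
open Finset

namespace Literature.MathematicalPhysics.QuantumFieldTheory.Balaban1983to89.B6NormSuppDecayWindowV1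

open LatticeFieldCalculus
open B3TorusRadialSums (cdist cdist_le_supDist supDist_comm supDist_eq_zero_iff)
open B4TorusKernel.MultiPeriod (torusSupNorm torusSupNorm_le_supNorm)
open B4ContourShift (supNorm exists_supNorm_eq)
open B4Reflection242 (boxDom)
open B5Eq118OneStroke (iterBlockOf)
open B5Eq117TorusCarriers (Mk)
open B6LowerBound2153Torus (rep)
open B6MultiLevelBoxOperator (N0)
open B6MultiLevelTorusOperator (TDomains)
open B6Geom246MultiLevelBox (bset blkOf coord_bounds lev_eq_of_blkOf_eq)
open B6Geom246MultiLevelTorus (geomT)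
open B6GlobalChartV1 (PV toBox toBox_apply blkV1)
open B6AgreeLapV1Chart (cB eB eS DeepS deepS_mono posV mem_cB_W val_eS eB_eq_chartBond)
open B6Prop25TwoScaleCensus (TSIdx)
open B6Ineq2133TwoScaleV1 (tsGeo)
open B6Prop26ReachTransplant (restrictOp transplant restrictOp_apply_of_injOn transplant_apply chartBond chartBond_src
  rep_iterBlockOf_siteOfInt InWindow)
open B6Prop26Gluing (ind ind_of_mem ind_of_not_mem)
open B6RandomWalkInputNorm (HasMajorantA NormSupp)
open B6InDecayWindowV1 (rel_window supNorm_div_le_of_band_right expKernel_of_supNorm_le inWindow_of_mem_W hglob_W)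
open B6HolderPairWindowV1 (abs_val_sub_val_le_cdist cdist_intCast_le)
open B6BlockHolderLipschitzV1 (supDist_le_of_cdist_le)
open B6HolderNormV1 (AdmV1 tparV1 supNormV1 holderV1 tparV1_pos tparV1_le_div abs_le_supNormV1 supNormV1_nonneg le_holderV1
  holderV1_nonneg)
open BalabanImbrieJaffe1984to88.BIJ85Prop12BridgeGeometry (two_le_Mk)

/-! ## §1  Class algebra for the in-reach class `y′ ∈ S ∧ adm` -/

section Generic

variable {g : B6.Geometry} {X : Type}

/-- a majorant for a class is one for its in-reach restriction. [cite: Balaban1984PropagatorsII, (2.133) p.247 («y′ ∈ 𝔅 ∩ T_□»), bookkeeping] -/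
theorem hasMajorantA_inCl_of_hasMajorantA (blk : X → g.Site) {adm : (X → ℝ) → g.Site → ℝ → Prop} (S : Set g.Site)
    {T : Module.End ℝ (X → ℝ)} {K : g.Site → g.Site → ℝ} (h : HasMajorantA blk adm T K) :
    HasMajorantA blk (fun μ y' B => y' ∈ S ∧ adm μ y' B) T K :=
  fun y' μ B hμ x => h y' μ B hμ.2 x

/-- the in-reach class depends on the reach only through its members. [cite: Balaban1984PropagatorsII, (2.133) p.247, bookkeeping] -/
theorem hasMajorantA_inCl_congr_set (blk : X → g.Site) {adm : (X → ℝ) → g.Site → ℝ → Prop} {S S' : Set g.Site}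
    (hS : ∀ y, y ∈ S' → y ∈ S) {T : Module.End ℝ (X → ℝ)} {K : g.Site → g.Site → ℝ}
    (h : HasMajorantA blk (fun μ y' B => y' ∈ S ∧ adm μ y' B) T K) :
    HasMajorantA blk (fun μ y' B => y' ∈ S' ∧ adm μ y' B) T K :=
  fun y' μ B hμ x => h y' μ B ⟨hS y' hμ.1, hμ.2⟩ x

/-- **A RIGHT FACTOR FEEDING THE REACH**: if `T ≺ K` for the in-reach class `y′ ∈ S ∧ adm′`, and `E` carries the `adm`-inputs at `y′ ∈ S` into
`adm′`-inputs at `y′` of size `κB` and KILLS the `adm`-inputs at `y′ ∉ S`, then `T·E ≺_{adm} 1_S(y′)·κ·K` — how the cut-offs `h_□`, `S_νh_□` of the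
legs of (2.141) restore an unrestricted input class. [cite: Balaban1984PropagatorsII, (2.141) p.247 + (2.52) p.232; derivation ours] -/
theorem hasMajorantA_mul_right_ind (blk : X → g.Site) {adm adm' : (X → ℝ) → g.Site → ℝ → Prop} (S : Set g.Site)
    {T E : Module.End ℝ (X → ℝ)} {K : g.Site → g.Site → ℝ} {κ : ℝ}
    (hT : HasMajorantA blk (fun μ y' B => y' ∈ S ∧ adm' μ y' B) T K)
    (hE : ∀ (μ : X → ℝ) (y' : g.Site) (B : ℝ), adm μ y' B → y' ∈ S → adm' (E μ) y' (κ * B))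
    (hkill : ∀ (μ : X → ℝ) (y' : g.Site) (B : ℝ), adm μ y' B → y' ∉ S → E μ = 0) :
    HasMajorantA blk adm (T * E) (fun a b => ind S b * (κ * K a b)) := by
  intro y' μ B hμ x
  beta_reduce
  rw [Module.End.mul_apply]
  by_cases hy : y' ∈ S
  · rw [ind_of_mem hy, one_mul]
    calc |T (E μ) x| ≤ K (blk x) y' * (κ * B) := hT y' (E μ) (κ * B) ⟨hy, hE μ y' B hμ hy⟩ x
      _ = κ * K (blk x) y' * B := by ring
  · rw [hkill μ y' B hμ hy, map_zero, Pi.zero_apply, abs_zero, ind_of_not_mem hy, zero_mul, zero_mul]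

end Generic

/-! ## §2  Window facts: member-close to a deep point is globally close; the member blocks over one global block -/

section Window

variable {d ℓ : ℕ} {hd : 1 ≤ d + 1} {hL : Odd (ℓ + 1) ∧ 1 < ℓ + 1} {a₀ a₁ : ℝ} {m K : ℕ}
variable {t : TSIdx d (ℓ + 1) hd hL a₀ a₁} {x₀ : Fin (d + 1) → ℤ}

/-- `|a − b| ≤ |a| + |b|` in the form used below. [folklore] -/
private theorem abs_sub_le_add (a b : ℝ) : |a - b| ≤ |a| + |b| := abs_sub a b

/-- **MEMBER-CLOSE TO A DEEP POINT IS GLOBALLY CLOSE**: if `z` keeps the margin `D′` in the window, `z′` is a window point and the charted points are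
within member sup-distance `D′`, then the global sup-distance of `z, z′` is at most the member one (no wrap of `T_□` inside the margin, no wrap of the
global torus inside the window). [cite: Balaban1984PropagatorsII, p.238 (T_□ = □̃³ with periodicity conditions); derivation ours] -/
theorem supDist_le_supDist_eS {D' : ℕ} {z z' : Site (PV d ℓ m K hd hL) 0} (hz : z ∈ DeepS t x₀ D') (hz' : z' ∈ DeepS t x₀ 0)
    (h : supDist (eS t x₀ z) (eS t x₀ z') ≤ D') : supDist z z' ≤ supDist (eS t x₀ z) (eS t x₀ z') := by
  have hz0 : z ∈ DeepS t x₀ 0 := deepS_mono (Nat.zero_le _) hz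
  refine supDist_le_of_cdist_le _ _ fun μ => ?_
  have ha := val_eS hz0 μ
  have hb := val_eS hz' μ
  obtain ⟨hd1, hd2⟩ := hz μ
  have hs : cdist (eS t x₀ z' μ - eS t x₀ z μ) ≤ supDist (eS t x₀ z) (eS t x₀ z') := by
    rw [supDist_comm]; exact cdist_le_supDist (eS t x₀ z') (eS t x₀ z) μ
  have hsD : cdist (eS t x₀ z' μ - eS t x₀ z μ) ≤ D' := hs.trans h
  have hlo : cdist (eS t x₀ z' μ - eS t x₀ z μ) ≤ (eS t x₀ z μ).val := by
    have h1 : ((D' : ℕ) : ℤ) ≤ (((eS t x₀ z μ).val : ℕ) : ℤ) := by rw [ha]; omega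
    have h2 : D' ≤ (eS t x₀ z μ).val := by exact_mod_cast h1
    exact hsD.trans h2
  have hhi : (eS t x₀ z μ).val + cdist (eS t x₀ z' μ - eS t x₀ z μ) < t.P.sitesPerDir 0 := by
    have h1 : (((eS t x₀ z μ).val : ℕ) : ℤ) + D' < (t.P.sitesPerDir 0 : ℕ) := by rw [ha]; omega
    have h2 : (eS t x₀ z μ).val + D' < t.P.sitesPerDir 0 := by exact_mod_cast h1
    omega
  have key := abs_val_sub_val_le_cdist hlo hhi
  rw [ha, hb] at key
  have key' : |(((z' μ).val : ℕ) : ℤ) - ((z μ).val : ℕ)| ≤ (cdist (eS t x₀ z' μ - eS t x₀ z μ) : ℤ) := by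
    have e : ((((z' μ).val : ℕ) : ℤ) - x₀ μ) - ((((z μ).val : ℕ) : ℤ) - x₀ μ) = (((z' μ).val : ℕ) : ℤ) - ((z μ).val : ℕ) := by ring
    rw [e] at key
    exact key
  -- the global circular distance is at most the label difference
  have hg : (cdist (z μ - z' μ) : ℤ) ≤ |(((z μ).val : ℕ) : ℤ) - ((z' μ).val : ℕ)| := by
    have h1 := cdist_intCast_le (n := (PV d ℓ m K hd hL).sitesPerDir 0) ((((z μ).val : ℕ) : ℤ) - ((z' μ).val : ℕ))
    have e : ((((((z μ).val : ℕ) : ℤ) - ((z' μ).val : ℕ) : ℤ)) : ZMod ((PV d ℓ m K hd hL).sitesPerDir 0)) = z μ - z' μ := by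
      push_cast
      rw [ZMod.natCast_zmod_val, ZMod.natCast_zmod_val]
    rw [e] at h1
    exact h1
  rw [abs_sub_comm] at hg
  have h3 : (cdist (z μ - z' μ) : ℤ) ≤ (cdist (eS t x₀ z' μ - eS t x₀ z μ) : ℤ) := hg.trans key'
  have h4 : cdist (z μ - z' μ) ≤ cdist (eS t x₀ z' μ - eS t x₀ z μ) := by exact_mod_cast h3
  exact h4.trans hs

variable {Mh k R : ℕ} {P' : Fin (d + 1) → ℕ} (hN : ∀ μ, N0 ℓ Mh k P' μ = (PV d ℓ m K hd hL).sitesPerDir 0) (D : TDomains d ℓ Mh k P' R)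
variable {hx₀ : ∀ μ, 0 ≤ x₀ μ} {hfit : ∀ μ, x₀ μ + (t.P.sitesPerDir 0 : ℕ) ≤ ((PV d ℓ m K hd hL).sitesPerDir 0 : ℕ)}

/-- **THE MEMBER BLOCKS OVER ONE GLOBAL BLOCK LIE WITHIN `|·|_T ≤ L − 1`**: two bonds of the full window in the SAME block of `D` (of level `j` or
`j + 1`; corner `x₀ ∈ L^jℤ^{d+1}`) chart to `j`-blocks of `T_□` at torus sup-distance `≤ L − 1`.
[cite: Balaban1984PropagatorsII, (2.1) p.224, p.238 (T_□ = □̃³); Balaban1984PropagatorsI, (1.16)–(1.18) p.20; derivation ours] -/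
theorem tdist_fibre_le (hdiv : ∀ μ, (((ℓ + 1) ^ t.j : ℕ) : ℤ) ∣ x₀ μ)
    (hlev : ∀ z ∈ boxDom (N0 ℓ Mh k P'), (∀ μ, x₀ μ ≤ z μ ∧ z μ < x₀ μ + (t.P.sitesPerDir 0 : ℕ)) → t.j ≤ D.lev z ∧ D.lev z ≤ t.j + 1)
    {b b₁ : PBond (PV d ℓ m K hd hL) 0} (hb : b ∈ (cB t x₀ hx₀ hfit).W) (hb₁ : b₁ ∈ (cB t x₀ hx₀ hfit).W)
    (heq : blkV1 hN D b = blkV1 hN D b₁) :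
    t.tdist (iterBlockOf t.j (eB t x₀ b).src) (iterBlockOf t.j (eB t x₀ b₁).src) ≤ (ℓ : ℝ) := by
  have hWin : ∀ x ∈ (cB t x₀ hx₀ hfit).W, InWindow posV x₀ (t.P.sitesPerDir 0) x := fun x hx => inWindow_of_mem_W hx
  obtain ⟨hz0, hzN⟩ := rel_window t le_rfl hWin hb
  obtain ⟨hz0₁, hzN₁⟩ := rel_window t le_rfl hWin hb₁
  rw [eB_eq_chartBond ((mem_cB_W (hx₀ := hx₀) (hfit := hfit)).1 hb), eB_eq_chartBond ((mem_cB_W (hx₀ := hx₀) (hfit := hfit)).1 hb₁)]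
  simp only [chartBond_src]
  unfold TSIdx.tdist
  refine (torusSupNorm_le_supNorm (fun μ => le_trans (by norm_num) (two_le_Mk t.P t.j μ)) _).trans ?_
  obtain ⟨μ, hμ⟩ := exists_supNorm_eq (rep (Mk t.P t.j) (iterBlockOf t.j (B6Prop26ReachTransplant.siteOfInt t fun μ => posV b μ - x₀ μ)) -
    rep (Mk t.P t.j) (iterBlockOf t.j (B6Prop26ReachTransplant.siteOfInt t fun μ => posV b₁ μ - x₀ μ)))
  rw [hμ, Pi.sub_apply, rep_iterBlockOf_siteOfInt t hz0 hzN μ, rep_iterBlockOf_siteOfInt t hz0₁ hzN₁ μ]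
  -- the common block `y` and its level `tl ∈ {j, j + 1}`
  set y := blkV1 hN D b₁ with hy
  have hby : blkOf D.toDomains (toBox hN b.src) = y := heq
  have hby₁ : blkOf D.toDomains (toBox hN b₁.src) = y := rfl
  obtain ⟨hlo, hhi⟩ := coord_bounds D.toDomains hby μ
  obtain ⟨hlo₁, hhi₁⟩ := coord_bounds D.toDomains hby₁ μ
  have hwin₁ : ∀ μ, x₀ μ ≤ (toBox hN b₁.src).1 μ ∧ (toBox hN b₁.src).1 μ < x₀ μ + (t.P.sitesPerDir 0 : ℕ) := fun μ => hWin b₁ hb₁ μ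
  have hl := hlev _ (toBox hN b₁.src).2 hwin₁
  have el : D.lev (toBox hN b₁.src) = y.1.1 := lev_eq_of_blkOf_eq D.toDomains hby₁
  rw [el] at hl
  -- arithmetic of the labels
  set Lj : ℤ := (((ℓ + 1) ^ t.j : ℕ) : ℤ) with hLj
  have hLj0 : 0 < Lj := by rw [hLj]; positivity
  set c₀ : ℤ := (((ℓ + 1) ^ y.1.1 : ℕ) : ℤ) * y.1.2 μ - x₀ μ with hc₀
  have hdvd : Lj ∣ c₀ :=
    dvd_sub (dvd_mul_of_dvd_left (by rw [hLj]; exact_mod_cast pow_dvd_pow (ℓ + 1) hl.1) _) (hdiv μ)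
  obtain ⟨a, ha⟩ := hdvd
  have hpow : (((ℓ + 1) ^ y.1.1 : ℕ) : ℤ) ≤ ((ℓ + 1 : ℕ) : ℤ) * Lj := by
    rw [hLj, ← Nat.cast_mul, ← pow_succ']
    exact_mod_cast Nat.pow_le_pow_right (Nat.succ_pos ℓ) hl.2
  have key : ∀ p : ℤ, (((ℓ + 1) ^ y.1.1 : ℕ) : ℤ) * y.1.2 μ ≤ p → p < (((ℓ + 1) ^ y.1.1 : ℕ) : ℤ) * y.1.2 μ + (((ℓ + 1) ^ y.1.1 : ℕ) : ℤ) →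
      a ≤ (p - x₀ μ) / Lj ∧ (p - x₀ μ) / Lj ≤ a + ℓ := by
    intro p h1 h2
    have e : p - x₀ μ = (p - x₀ μ - c₀) + a * Lj := by rw [ha]; ring
    have hρ0 : 0 ≤ p - x₀ μ - c₀ := by rw [hc₀]; linarith
    have hρ1 : p - x₀ μ - c₀ < ((ℓ + 1 : ℕ) : ℤ) * Lj := by rw [hc₀]; linarith
    rw [e, Int.add_mul_ediv_right _ _ hLj0.ne']
    constructor
    · linarith [Int.ediv_nonneg hρ0 hLj0.le]
    · have h3 : (p - x₀ μ - c₀) / Lj < ((ℓ + 1 : ℕ) : ℤ) := Int.ediv_lt_of_lt_mul hLj0 hρ1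
      push_cast at h3
      linarith
  obtain ⟨q1, q2⟩ := key (posV b μ) hlo hhi
  obtain ⟨r1, r2⟩ := key (posV b₁ μ) hlo₁ hhi₁
  have hfin : |(posV b μ - x₀ μ) / Lj - (posV b₁ μ - x₀ μ) / Lj| ≤ (ℓ : ℤ) := abs_sub_le_iff.2 ⟨by linarith, by linarith⟩
  exact_mod_cast hfin

/-! ## §3  The band bridge for the Hölder class -/

/-- **THE BAND BRIDGE FOR HÖLDER-CLASS INPUTS, ON `T_η`**: let a member operator `T′` on the bond functions of `T_□` have an admissible-input majorant
`A·e^{−δ|y−y′|_{T_□}}` for the class of inputs supported within `|·|_T ≤ L − 1` of `y′` with member size `‖·‖_ε + |·| ≤ B` (`ε ≥ 0`); let the corner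
`x₀ ≥ 0` have the full member period inside the box, `L^j ∣ x₀`, the full window two-level (`j`, `j + 1`), and let every window bond with block in the
reach `S` have labels in the middle band (`C ≥ 1`) and be `L^j`-deep.  Then the full-window transplant `ε T′ ρ` has, for the census class
«supp J ⊂ Δ(y′), ‖J‖_ε + |J| ≤ B» at inputs `y′ ∈ S`, the majorant `3A·e^{2δ/C}·e^{−(δ/((d+1)C))·d_T}` — outputs ANYWHERE.
[cite: Balaban1984PropagatorsII, (2.138) p.247, (2.133) p.247, (2.90)–(2.91) p.239, p.238 (T_□ = □̃³); Balaban1984PropagatorsI, (1.109) p.35] -/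
theorem normSuppDecay_window_V1 {T' : Module.End ℝ (PBond t.P 0 → ℝ)} {A δ ε : ℝ} (hA : 0 ≤ A) (hδ : 0 ≤ δ) (hε : 0 ≤ ε)
    (hT' : HasMajorantA (g := tsGeo t 0 0) (fun β : PBond t.P 0 => iterBlockOf t.j β.src)
      (NormSupp (g := tsGeo t 0 0) (fun β : PBond t.P 0 => iterBlockOf t.j β.src) (fun y' => {y'' | t.tdist y'' y' ≤ (ℓ : ℝ)})
        (fun _ f => t.hqB ε (WithLp.toLp 2 f) + t.supNormTS (.vec (WithLp.toLp 2 f)))) T'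
      (fun y y' => A * Real.exp (-(δ * t.tdist y y'))))
    (hMh : 1 ≤ Mh) (hP : ∀ μ, 1 ≤ P' μ) (hdiv : ∀ μ, (((ℓ + 1) ^ t.j : ℕ) : ℤ) ∣ x₀ μ)
    (hlev : ∀ z ∈ boxDom (N0 ℓ Mh k P'), (∀ μ, x₀ μ ≤ z μ ∧ z μ < x₀ μ + (t.P.sitesPerDir 0 : ℕ)) → t.j ≤ D.lev z ∧ D.lev z ≤ t.j + 1)
    {C : ℕ} (hC : 1 ≤ C) (S : Set (geomT D).Site)
    (hband : ∀ b ∈ (cB t x₀ hx₀ hfit).W, blkV1 hN D b ∈ S → ∀ μ,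
      ((t.P.sitesPerDir t.j : ℕ) : ℤ) ≤ (C + 1) * ((posV b μ - x₀ μ) / (((ℓ + 1) ^ t.j : ℕ) : ℤ) + 1) ∧
        ((C : ℤ) + 1) * ((posV b μ - x₀ μ) / (((ℓ + 1) ^ t.j : ℕ) : ℤ)) ≤ C * ((t.P.sitesPerDir t.j : ℕ) : ℤ))
    (hdeep : ∀ b ∈ (cB t x₀ hx₀ hfit).W, blkV1 hN D b ∈ S → b.src ∈ DeepS t x₀ ((ℓ + 1) ^ t.j)) :
    HasMajorantA (g := geomT D) (blkV1 hN D)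
      (fun J y' B => y' ∈ S ∧ NormSupp (g := geomT D) (blkV1 hN D) (fun y' => ({y'} : Set (geomT D).Site))
        (fun _ J => holderV1 hN D ε J + supNormV1 J) J y' B)
      (transplant (cB t x₀ hx₀ hfit).W (eB t x₀) T')
      (fun a b => 3 * (A * Real.exp (δ * ((d + 1 : ℝ) + (d + 1)) / ((d + 1) * C))) *
        Real.exp (-(δ / ((d + 1) * C) * (geomT D).dist a b))) := by
  classical
  intro y' μ B hμB x
  obtain ⟨hyS, hμ⟩ := hμB
  have hB : 0 ≤ B := hμ.nonneg
  have hinj : Set.InjOn (eB t x₀) ((cB t x₀ hx₀ hfit).W : Set (PBond (PV d ℓ m K hd hL) 0)) := (cB t x₀ hx₀ hfit).inj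
  have hsurj : ∀ β : PBond t.P 0, ∃ b ∈ (cB t x₀ hx₀ hfit).W, eB t x₀ b = β := (cB t x₀ hx₀ hfit).surj
  have hWin : ∀ b ∈ (cB t x₀ hx₀ hfit).W, InWindow posV x₀ (t.P.sitesPerDir 0) b := fun b hb => inWindow_of_mem_W hb
  have hRHS0 : 0 ≤ 3 * (A * Real.exp (δ * ((d + 1 : ℝ) + (d + 1)) / ((d + 1) * C))) *
      Real.exp (-(δ / ((d + 1) * C) * (geomT D).dist (blkV1 hN D x) y')) * B := by positivity
  rw [transplant_apply]
  by_cases hxW : x ∈ (cB t x₀ hx₀ hfit).W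
  swap
  · rw [if_neg hxW, abs_zero]; exact hRHS0
  rw [if_pos hxW]
  set f : PBond t.P 0 → ℝ := restrictOp (cB t x₀ hx₀ hfit).W (eB t x₀) μ with hf
  have hfval : ∀ b ∈ (cB t x₀ hx₀ hfit).W, f (eB t x₀ b) = μ b := fun b hb => restrictOp_apply_of_injOn hinj μ hb
  by_cases hex : ∃ x₁ ∈ (cB t x₀ hx₀ hfit).W, μ x₁ ≠ 0
  swap
  · push Not at hex
    have hf0 : f = 0 := by
      funext β
      obtain ⟨b, hb, rfl⟩ := hsurj β
      rw [hfval b hb, Pi.zero_apply]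
      exact hex b hb
    rw [hf0, map_zero, Pi.zero_apply, abs_zero]; exact hRHS0
  obtain ⟨x₁, hx₁W, hx₁⟩ := hex
  -- the input block: every active bond lies in `y′`
  have hblk : ∀ b, μ b ≠ 0 → blkV1 hN D b = y' := fun b hb => by
    by_contra hne
    exact hb (hμ.off b fun hmem => hne (Set.mem_singleton_iff.1 hmem))
  have hy1 : blkV1 hN D x₁ = y' := hblk x₁ hx₁
  have hy1S : blkV1 hN D x₁ ∈ S := by rw [hy1]; exact hyS
  -- the window blocks have level `≥ j`
  have hlevW : ∀ b ∈ (cB t x₀ hx₀ hfit).W, t.j ≤ (blkV1 hN D b).1.1 := fun b hb => by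
    have hw : ∀ μ, x₀ μ ≤ (toBox hN b.src).1 μ ∧ (toBox hN b.src).1 μ < x₀ μ + (t.P.sitesPerDir 0 : ℕ) := fun μ => hWin b hb μ
    have h := (hlev _ (toBox hN b.src).2 hw).1
    have el : D.lev (toBox hN b.src) = (blkV1 hN D b).1.1 := lev_eq_of_blkOf_eq D.toDomains rfl
    rwa [el] at h
  -- sizes of the input
  have hSup := supNormV1_nonneg μ
  have hHol := holderV1_nonneg hN D ε μ
  have hbound : holderV1 hN D ε μ + supNormV1 μ ≤ B := hμ.bound
  -- (sup) `|ρJ| ≤ |J|`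
  have hfabs : ∀ β, |f β| ≤ supNormV1 μ := fun β => by
    obtain ⟨b, hb, rfl⟩ := hsurj β
    rw [hfval b hb]
    exact abs_le_supNormV1 μ b
  have hsupTS : t.supNormTS (.vec (WithLp.toLp 2 f)) ≤ supNormV1 μ := by
    unfold TSIdx.supNormTS
    exact LatticeNorms.supNorm_le hSup fun β _ => by rw [Real.norm_eq_abs]; exact hfabs β
  -- (Hölder) `‖ρJ‖_ε ≤ ‖J‖_ε + 2|J|`
  have hqB : t.hqB ε (WithLp.toLp 2 f) ≤ holderV1 hN D ε μ + 2 * supNormV1 μ := by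
    unfold TSIdx.hqB
    refine LatticeNorms.supNorm_le (by positivity) ?_
    rintro ⟨β, β'⟩ hp
    simp only [Finset.mem_filter, Finset.mem_univ, true_and] at hp
    obtain ⟨hsrc, hdir⟩ := hp
    obtain ⟨b, hb, rfl⟩ := hsurj β
    obtain ⟨b', hb', rfl⟩ := hsurj β'
    change ‖(f (eB t x₀ b') - f (eB t x₀ b)) / t.fdist (eB t x₀ b).src (eB t x₀ b').src ^ ε‖ ≤ _
    rw [hfval b hb, hfval b' hb']
    have hfd : 0 < t.fdist (eB t x₀ b).src (eB t x₀ b').src := t.fdist_pos hsrc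
    have hfdε : 0 < t.fdist (eB t x₀ b).src (eB t x₀ b').src ^ ε := Real.rpow_pos_of_pos hfd ε
    rw [Real.norm_eq_abs, abs_div, abs_of_pos hfdε, div_le_iff₀ hfdε]
    by_cases hfar : 1 ≤ t.fdist (eB t x₀ b).src (eB t x₀ b').src
    · have h1 : 1 ≤ t.fdist (eB t x₀ b).src (eB t x₀ b').src ^ ε := Real.one_le_rpow hfar hε
      calc |μ b' - μ b| ≤ |μ b'| + |μ b| := abs_sub_le_add _ _
        _ ≤ supNormV1 μ + supNormV1 μ := add_le_add (abs_le_supNormV1 μ b') (abs_le_supNormV1 μ b)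
        _ ≤ (holderV1 hN D ε μ + 2 * supNormV1 μ) * 1 := by linarith
        _ ≤ (holderV1 hN D ε μ + 2 * supNormV1 μ) * t.fdist (eB t x₀ b).src (eB t x₀ b').src ^ ε :=
            mul_le_mul_of_nonneg_left h1 (by positivity)
    · push Not at hfar
      by_cases h0 : μ b = 0 ∧ μ b' = 0
      · rw [h0.1, h0.2, sub_zero, abs_zero]; positivity
      · have hact : μ b ≠ 0 ∨ μ b' ≠ 0 := by
          by_contra hno
          push Not at hno
          exact h0 hno
        -- member distance `< L^j`
        have hDm : supDist (eB t x₀ b).src (eB t x₀ b').src < (ℓ + 1) ^ t.j := by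
          rw [t.fdist_eq, div_lt_one (by positivity)] at hfar
          exact_mod_cast hfar
        have hDm' : supDist (eB t x₀ b').src (eB t x₀ b).src < (ℓ + 1) ^ t.j := by rwa [supDist_comm]
        -- the active end is deep, so the global distance is at most the member one
        have hglob : supDist b.src b'.src ≤ supDist (eB t x₀ b).src (eB t x₀ b').src := by
          rcases hact with h | h
          · have hdb := hdeep b hb (by rw [hblk b h]; exact hyS)
            exact supDist_le_supDist_eS (deepS_mono hDm.le hdb) ((mem_cB_W (hx₀ := hx₀) (hfit := hfit)).1 hb') le_rfl
          · have hdb := hdeep b' hb' (by rw [hblk b' h]; exact hyS)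
            have h2 := supDist_le_supDist_eS (deepS_mono hDm'.le hdb) ((mem_cB_W (hx₀ := hx₀) (hfit := hfit)).1 hb) le_rfl
            rw [supDist_comm] at h2
            exact h2.trans (le_of_eq (supDist_comm _ _))
        -- the global pair is admissible and its parameter is at most the member quotient
        have hlb := hlevW b hb
        have hlb' := hlevW b' hb'
        have hpowb : (ℓ + 1) ^ t.j ≤ (ℓ + 1) ^ (blkV1 hN D b).1.1 := Nat.pow_le_pow_right (Nat.succ_pos ℓ) hlb
        have hpowb' : (ℓ + 1) ^ t.j ≤ (ℓ + 1) ^ (blkV1 hN D b').1.1 := Nat.pow_le_pow_right (Nat.succ_pos ℓ) hlb'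
        have hadm : AdmV1 hN D b b' :=
          ⟨hdir, (hglob.trans hDm.le).trans hpowb, (hglob.trans hDm.le).trans hpowb'⟩
        have hne : b.src ≠ b'.src := fun h => hsrc (by
          show eS t x₀ b.src = eS t x₀ b'.src
          rw [h])
        have htpos : 0 < tparV1 hN D b b' := tparV1_pos hN D hne
        have htle : tparV1 hN D b b' ≤ t.fdist (eB t x₀ b).src (eB t x₀ b').src := by
          refine (tparV1_le_div hN D hlb).trans ?_
          rw [t.fdist_eq]
          exact div_le_div_of_nonneg_right (by exact_mod_cast hglob) (by positivity)
        have hH := le_holderV1 hN D ε μ hadm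
        have e1 : |μ b' - μ b| = tparV1 hN D b b' ^ ε * (tparV1 hN D b b' ^ (-ε) * |μ b - μ b'|) := by
          rw [abs_sub_comm, ← mul_assoc, ← Real.rpow_add htpos, add_neg_cancel, Real.rpow_zero, one_mul]
        rw [e1]
        have hpowle : tparV1 hN D b b' ^ ε ≤ t.fdist (eB t x₀ b).src (eB t x₀ b').src ^ ε := Real.rpow_le_rpow htpos.le htle hε
        calc tparV1 hN D b b' ^ ε * (tparV1 hN D b b' ^ (-ε) * |μ b - μ b'|)
            ≤ t.fdist (eB t x₀ b).src (eB t x₀ b').src ^ ε * holderV1 hN D ε μ :=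
              mul_le_mul hpowle hH (mul_nonneg (Real.rpow_nonneg htpos.le _) (abs_nonneg _)) hfdε.le
          _ ≤ (holderV1 hN D ε μ + 2 * supNormV1 μ) * t.fdist (eB t x₀ b).src (eB t x₀ b').src ^ ε := by
              nlinarith [hfdε.le, hSup]
  -- the member class: the member block of the active bond `x₁`, radius `L − 1`, size `3B`
  have hf_class : NormSupp (g := tsGeo t 0 0) (fun β : PBond t.P 0 => iterBlockOf t.j β.src) (fun y' => {y'' | t.tdist y'' y' ≤ (ℓ : ℝ)})
      (fun _ f => t.hqB ε (WithLp.toLp 2 f) + t.supNormTS (.vec (WithLp.toLp 2 f))) f (iterBlockOf t.j (eB t x₀ x₁).src) (3 * B) := by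
    refine ⟨by positivity, ?_, fun β hβ => ?_⟩
    · calc t.hqB ε (WithLp.toLp 2 f) + t.supNormTS (.vec (WithLp.toLp 2 f))
          ≤ (holderV1 hN D ε μ + 2 * supNormV1 μ) + supNormV1 μ := add_le_add hqB hsupTS
        _ ≤ 3 * B := by linarith
    · by_contra hne
      obtain ⟨b, hb, rfl⟩ := hsurj β
      rw [hfval b hb] at hne
      have heq : blkV1 hN D b = blkV1 hN D x₁ := by rw [hblk b hne, hy1]
      exact hβ (tdist_fibre_le hN D hdiv hlev hb hx₁W heq)
  -- the member majorant at the output bond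
  have hmem := hT' (iterBlockOf t.j (eB t x₀ x₁).src) f (3 * B) hf_class (eB t x₀ x)
  -- the kernel comparison (band bridge)
  have hs := supNorm_div_le_of_band_right t 0 0 posV PBond.dir x₀ le_rfl (cB t x₀ hx₀ hfit).W hWin hC hxW hx₁W (hband x₁ hx₁W hy1S)
  have hgl := hglob_W hN D hMh hP (fun z hz hw => (hlev z hz hw).1) x hxW x₁ hx₁W
  have hker := expKernel_of_supNorm_le (A := A) (δ := δ) hA hδ hC (κ := (d : ℝ) + 1) (c := (d : ℝ) + 1) (by positivity) hs hgl
  rw [← eB_eq_chartBond ((mem_cB_W (hx₀ := hx₀) (hfit := hfit)).1 hxW),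
    ← eB_eq_chartBond ((mem_cB_W (hx₀ := hx₀) (hfit := hfit)).1 hx₁W), hy1] at hker
  calc |T' f (eB t x₀ x)| ≤ A * Real.exp (-(δ * t.tdist (iterBlockOf t.j (eB t x₀ x).src) (iterBlockOf t.j (eB t x₀ x₁).src))) * (3 * B) := hmem
    _ ≤ A * Real.exp (δ * (((d : ℝ) + 1) + ((d : ℝ) + 1)) / (((d : ℝ) + 1) * C)) *
          Real.exp (-(δ / (((d : ℝ) + 1) * C) * (geomT D).dist (blkV1 hN D x) y')) * (3 * B) :=
        mul_le_mul_of_nonneg_right hker (by positivity)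
    _ = 3 * (A * Real.exp (δ * ((d + 1 : ℝ) + (d + 1)) / ((d + 1) * C))) *
          Real.exp (-(δ / ((d + 1) * C) * (geomT D).dist (blkV1 hN D x) y')) * B := by ring

end Window

end Literature.MathematicalPhysics.QuantumFieldTheory.Balaban1983to89.B6NormSuppDecayWindowV1

end
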